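import Literature.MathematicalPhysics.QuantumFieldTheory.ConformalBootstrap3D.PointKernelK34L505Data
import Literature.MathematicalPhysics.QuantumFieldTheory.ConformalBootstrap3D.PointKernelK34L505Segs
import Literature.MathematicalPhysics.QuantumFieldTheory.ConformalBootstrap3D.PointKernelParts

/-!
# K34L505 certificate, kernel part file P46: one-cell head segments 108, 109 in level ranges

The head cells whose kernel evaluation exceeds one `decide` are one-cell segments of `hsegsK34L505`; each is
checked by `PCert.hPartSideOK` (side conditions) and `PCert.hPartOK` per level range `[n_lo, n_lo + count)`
against an integer claim, the claims summing to `≥ 0` (`PointKernel.partsOK`); soundness is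
`PCert.hParts_sound` (`PointKernelParts`).  The part files are mutually independent (each imports only
the data file); the ranges of one cell may span several of them, and the per-cell conclusions
`hparts_i` / `hcell_i` of those cells are assembled in `PointKernelK34L505.lean`.
Estimated kernel time 235 s.
-/

set_option maxRecDepth 100000
set_option maxHeartbeats 0

namespace Literature.MathematicalPhysics.QuantumFieldTheory.ConformalBootstrap3D.PointKernelK34L505

open Literature.MathematicalPhysics.QuantumFieldTheory.ConformalBootstrap3D.PointKernel

/-- levels `[49, 56)` of segment 108: partial lower sum `≥` claim. [folklore] -/
theorem part_108_3 : certK34L505.hPartOK (PCert.segAt hsegsK34L505 108) JHK34L505 49 7 (1287362321739879914418706901140841786) = true := by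
  decide +kernel

/-- levels `[56, 61)` of segment 108: partial lower sum `≥` claim. [folklore] -/
theorem part_108_4 : certK34L505.hPartOK (PCert.segAt hsegsK34L505 108) JHK34L505 56 5 (447943688652748481846919218427079975) = true := by
  decide +kernel

/-- levels `[61, 65)` of segment 108: partial lower sum `≥` claim. [folklore] -/
theorem part_108_5 : certK34L505.hPartOK (PCert.segAt hsegsK34L505 108) JHK34L505 61 4 (201462296569069717829513511545651919) = true := by
  decide +kernel

/-- one-cell segment 109 (row 6, cell `[3589/512, 1795/256]`, chord, `n_F = 56`,
4 level ranges): side conditions. [folklore] -/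
theorem pside_109 : certK34L505.hPartSideOK (PCert.segAt hsegsK34L505 109) JHK34L505 = true := by
  decide +kernel

/-- its level ranges `(n_lo, count, claim)`. [folklore] -/
def partsK34L505_109 : List (ℕ × ℕ × ℤ) := [(0, 30, -16967094639229411753322189003262144259), (30, 13, 13357808177171837254773020427416992131), (43, 9, 2919021757098672918273827806087589805), (52, 5, 690264704958901580275340769757562323)]

/-- the ranges tile `[0, n_F]` and the claims sum to `≥ 0`. [folklore] -/
theorem pcov_109 : PointKernel.partsOK 56 partsK34L505_109 = true := by
  decide +kernel

/-- levels `[0, 30)` of segment 109: partial lower sum `≥` claim. [folklore] -/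
theorem part_109_0 : certK34L505.hPartOK (PCert.segAt hsegsK34L505 109) JHK34L505 0 30 (-16967094639229411753322189003262144259) = true := by
  decide +kernel

end Literature.MathematicalPhysics.QuantumFieldTheory.ConformalBootstrap3D.PointKernelK34L505
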